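/-
Copyright: formalisation for the LaceExpansionHighD cell (what-if lane, kernel instance at `d := 10`).
Source formalised: R. Fitzner, R. van der Hofstad, *Mean-field behavior for nearest-neighbor percolation in d > 10*
(the NoBLE analysis), §5.1.1 (5.4)–(5.5) pp. 1089–1090, §5.1.2 (5.14), (5.16) p. 1092, Lemma 5.1 p. 1093, §5.3.3 p. 1098.
-/
import Literature.Probability.FitznerVanDerHofstad2017.SrwWPatternRefKernelD10
import Literature.Probability.FitznerVanDerHofstad2017.SrwCountZipKernel
import HarnessLib

/-!
# Positional reference rows at DEEP law cuts — the `W`-pattern reference kernel on the zipped count row (`d := 10`)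

Add-on to `SrwWPatternRefKernelD10` (`WPatD10R`): the SAME positional certificate of a reference row — for a
descending parts list `b`, ONE law row forced once and, for every listed `(l, v)`, the check
`Σ_{l ≤ i < L} p_i(vecOfParts 10 b; 10) + Ext(L) ≤ v` with `Ext(L) ≥ srwIZeroExtQ 10 44 (tabHi 1) L` ((5.14):
`I_{1,l}(y) ≤ Σ_{l ≤ i < L} p_i(y) + I⁺_{1,L}(0)`, `SrwFarNodeBound.srwI_one_le_sum_add_zero` and
`SrwOriginTailKernel.srwI_one_zero_le_srwIZeroExtQ`) — with the law row taken from the deep engine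
`srwCountRowZip 10 L b` of `SrwCountZipKernel` (the binomial dimension recursion, zipped; `srwCountRowZip_getD`),
so that depths `L` beyond one hundred are within the kernel budget (about `18 s` per row at `L = 140`).

* §1 `partialFrom` over the zipped row: `srwLawPartialQ_eq_partialFrom_zip` (the landed fast-row partial sum equals
  the zipped one, as rationals) and **`srwIZeroExtQ_le_of_zip`** (the extended origin column at any `L > 44` decided
  through ONE zipped origin row);
* §2 `posValsZB` / `posRowZB` / **`posTableZB L ext prows`** (+ `_append` / `_cons` / `_filter`), `posRowZ_sound` and
  **`refValid_refRowsZ`**: a certified deep table yields `RefValid l (refRows prows l)` at every index;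
* §3 **`srwW_le_of_wPatLeTableZ`**: the landed table check `wPatLeTableR prows w rows` licensed by a deep table.

Pointer language only: an input-certification kernel of the what-if lane; every table module instantiating it is a
kernel instance at `d := 10` (input certificate), no statement about any other dimension.
-/

set_option Elab.async false

namespace Literature.Probability.FitznerVanDerHofstad2017

namespace WPatD10R

open Finset KTUD10 WPatD10 WPatD10Far
open SrwCount (coordD srwCount srwLaw_eq_srwCount_div)
open Literature.Barriers.CriticalPhenomena.LongRangePhi4 (srwLaw)

/-! ### §1. The law partial sum off the zipped row; the extended origin column at deep cuts -/

/-- `|coordD (vecOfParts 10 b) j| = b_j` (`0` beyond the list; `|b| ≤ 10`). [folklore] -/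
private theorem natAbs_coordD_vecOfParts' {b : List ℕ} (hb : b.length ≤ 10) (j : ℕ) :
    (coordD (vecOfParts 10 b) j).natAbs = b.getD j 0 := by
  unfold coordD vecOfParts
  split_ifs with hj
  · simp
  · rw [List.getD_eq_default _ _ (by omega)]; rfl

/-- **The fast-row partial sum equals the zipped-row partial sum** (as rationals; both read `c_{l+i}(vecOfParts 10 b)`):
`srwLawPartialQ 10 b l (L − l) = partialFrom (srwCountRowZip 10 L b) l L` for `l ≤ L`, `|b| ≤ 10`.
[cite: FitznerVanDerHofstad2016NoBLE, §5.1.1 (5.4)–(5.5) pp. 1089–1090] -/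
theorem srwLawPartialQ_eq_partialFrom_zip {b : List ℕ} (hb : b.length ≤ 10) {l L : ℕ} (hl : l ≤ L) :
    srwLawPartialQ 10 b l (L - l) = partialFrom (srwCountRowZip 10 L b) l L := by
  unfold srwLawPartialQ partialFrom
  rw [Nat.add_sub_cancel' hl]
  congr 1
  refine List.map_congr_left fun i hi => ?_
  have hi' : l + i ≤ L := by have := List.mem_range.1 hi; omega
  rw [srwCountRowFast_getD hb (natAbs_coordD_vecOfParts' hb) hi',
    srwCountRowZip_getD hb (natAbs_coordD_vecOfParts' hb) hi']

/-- `↑(partialFrom (srwCountRowZip 10 L b) l L) = Σ_{i < L−l} p_{l+i}(vecOfParts 10 b; 10)` (`l ≤ L`, `|b| ≤ 10`).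
[cite: FitznerVanDerHofstad2016NoBLE, §5.1.1 (5.4)–(5.5) pp. 1089–1090] -/
theorem partialFrom_zip_cast {b : List ℕ} (hb : b.length ≤ 10) {l L : ℕ} (hl : l ≤ L) :
    ((partialFrom (srwCountRowZip 10 L b) l L : ℚ) : ℝ) =
      ∑ i ∈ range (L - l), srwLaw 10 (l + i) (vecOfParts 10 b) := by
  rw [← srwLawPartialQ_eq_partialFrom_zip hb hl, srwLawPartialQ_cast hb (natAbs_coordD_vecOfParts' hb)]

/-- **The extended origin column at a deep cut, decided through ONE zipped origin row**: for `44 < L`,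
`srwIZeroExtQ 10 44 T44 L = T44 44 − partialFrom (srwCountRowZip 10 L []) 44 L`, hence any decided upper bound of the
right-hand side bounds the column. [cite: FitznerVanDerHofstad2016NoBLE, §5.1.2 (5.14) p. 1092] -/
theorem srwIZeroExtQ_le_of_zip {L : ℕ} (hL : 44 < L) {e : ℚ}
    (h : decide (T44 44 - partialFrom (srwCountRowZip 10 L []) 44 L ≤ e) = true) :
    srwIZeroExtQ 10 44 T44 L ≤ e := by
  rw [srwIZeroExtQ_of_lt T44 hL, srwLawPartialQ_eq_partialFrom_zip (b := []) (by simp) hL.le]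
  exact of_decide_eq_true h

/-! ### §2. Positional certification of reference rows on the zipped row -/

/-- Boolean value check of the listed `(l, v)`: ONE deep law row `srwCountRowZip 10 L b` (forced once), then
`l ≤ L ∧ Σ_{l ≤ i < L} p_i + ext ≤ v` for each pair (plumbing). [folklore] -/
def posValsZB (b : List ℕ) (L : ℕ) (ext : ℚ) (lvs : List (ℕ × ℚ)) : Bool :=
  seqListNat (srwCountRowZip 10 L b) fun row =>
    lvs.all fun lv => decide (lv.1 ≤ L ∧ partialFrom row lv.1 L + ext ≤ lv.2)

/-- The deep row check: facts and values (plumbing). [folklore] -/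
def posRowZB (L : ℕ) (ext : ℚ) (r : PRow) : Bool := posFactsB r.1 r.2.1 && posValsZB r.1 L ext r.2.2

/-- The deep table check: every row passes (plumbing). [folklore] -/
def posTableZB (L : ℕ) (ext : ℚ) (prows : List PRow) : Bool := prows.all (posRowZB L ext)

/-- Chunking of the deep table check. [cite: FitznerVanDerHofstad2016NoBLE, §5.3.3 p. 1098] -/
theorem posTableZB_append {L : ℕ} {ext : ℚ} {p₁ p₂ : List PRow} (h₁ : posTableZB L ext p₁ = true)
    (h₂ : posTableZB L ext p₂ = true) : posTableZB L ext (p₁ ++ p₂) = true := by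
  unfold posTableZB at *
  rw [List.all_append, h₁, h₂]; rfl

/-- Consing a certified deep row. [cite: FitznerVanDerHofstad2016NoBLE, §5.3.3 p. 1098] -/
theorem posTableZB_cons {L : ℕ} {ext : ℚ} {r : PRow} {rs : List PRow} (h₁ : posTableZB L ext [r] = true)
    (h₂ : posTableZB L ext rs = true) : posTableZB L ext (r :: rs) = true :=
  posTableZB_append (p₁ := [r]) h₁ h₂

/-- A sub-table (filter) of a certified deep table is certified. [cite: FitznerVanDerHofstad2016NoBLE, §5.3.3 p. 1098] -/
theorem posTableZB_filter {L : ℕ} {ext : ℚ} {ps : List PRow} (h : posTableZB L ext ps = true) (q : PRow → Bool) :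
    posTableZB L ext (ps.filter q) = true := by
  unfold posTableZB at *
  rw [List.all_eq_true] at h ⊢
  exact fun r hr => h r (List.mem_filter.mp hr).1

/-- **Soundness of one deep positional row** (`ext ≥` the extended origin column at `L`): every listed `(l, v)` has the
`RefValid` witness `vecOfParts 10 b` with `I_{1,l}(vecOfParts 10 b; 10) ≤ v` ((5.14): the law partial sum plus the
origin tail). [cite: FitznerVanDerHofstad2016NoBLE, §5.1.2 (5.14) p. 1092; Lemma 5.1 p. 1093] -/
theorem posRowZ_sound {L : ℕ} {ext : ℚ} (hext : srwIZeroExtQ 10 44 T44 L ≤ ext) {r : PRow}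
    (h : posRowZB L ext r = true) :
    ∀ lv ∈ r.2.2, ∃ b : Fin 10 → ℤ, Antitone b ∧ (∀ i, 0 ≤ b i) ∧ (∀ i, b i ≤ 12) ∧
      (∀ k : ℕ, k < 12 → r.2.1.getD k 0 = absTailCount b ((k : ℤ) + 1)) ∧
      srwI 10 1 lv.1 b ≤ ((lv.2 : ℚ) : ℝ) := by
  intro lv hlv
  unfold posRowZB posFactsB posValsZB at h
  simp only [Bool.and_eq_true, decide_eq_true_eq, seqListNat_eq, List.all_eq_true] at h
  obtain ⟨⟨hlen, hanti, hrange, htail⟩, hvals⟩ := h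
  obtain ⟨hl, hval⟩ := hvals lv hlv
  refine ⟨vecOfParts 10 r.1, fun a c hac => hanti a c hac, fun i => (hrange i).1, fun i => (hrange i).2,
    fun k hk => htail ⟨k, hk⟩, ?_⟩
  have hpos := srwI_one_le_sum_add_zero (d := 10) (by norm_num) lv.1 (L - lv.1) (vecOfParts 10 r.1)
  rw [Nat.add_sub_cancel' hl, ← partialFrom_zip_cast hlen hl] at hpos
  refine hpos.trans ?_
  have hz := srwI_one_zero_le_srwIZeroExtQ (d := 10) (by norm_num) T44_valid L
  have hq : partialFrom (srwCountRowZip 10 L r.1) lv.1 L + srwIZeroExtQ 10 44 T44 L ≤ lv.2 :=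
    (add_le_add le_rfl hext).trans hval
  calc ((partialFrom (srwCountRowZip 10 L r.1) lv.1 L : ℚ) : ℝ) + srwI 10 1 L 0
      ≤ ((partialFrom (srwCountRowZip 10 L r.1) lv.1 L : ℚ) : ℝ) + ((srwIZeroExtQ 10 44 T44 L : ℚ) : ℝ) :=
        add_le_add le_rfl hz
    _ ≤ ((lv.2 : ℚ) : ℝ) := by exact_mod_cast hq

/-- **A certified deep positional table yields a valid reference table at every index.**
[cite: FitznerVanDerHofstad2016NoBLE, §5.1.2 (5.14) p. 1092; Lemma 5.1 p. 1093] -/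
theorem refValid_refRowsZ {L : ℕ} {ext : ℚ} (hext : srwIZeroExtQ 10 44 T44 L ≤ ext) {prows : List PRow}
    (h : posTableZB L ext prows = true) (l : ℕ) : RefValid l (refRows prows l) := by
  intro ctv hmem
  unfold refRows at hmem
  rw [List.mem_filterMap] at hmem
  obtain ⟨r, hr, hsome⟩ := hmem
  obtain ⟨lv, hfind, rfl⟩ := Option.map_eq_some_iff.mp hsome
  have hlv : lv ∈ r.2.2 := List.mem_of_find?_eq_some hfind
  have hl : lv.1 = l := by simpa using List.find?_some hfind
  unfold posTableZB at h
  rw [List.all_eq_true] at h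
  obtain ⟨b, hanti, h0, h12, htail, hv⟩ := posRowZ_sound hext (h r hr) lv hlv
  exact ⟨b, hanti, h0, h12, htail, hl ▸ hv⟩

/-! ### §3. The table check licensed by a deep table -/

/-- **A certified `W`-table dominates `W_{1,j}(vecOfParts 10 p; 10)` on its rows** (`j ≤ 22`, `|p| ≤ 10`), given a
certified DEEP positional reference table (`posTableZB`, `ext ≥` the extended origin column at `L`); the table check
itself is the landed `wPatLeTableR`. [cite: FitznerVanDerHofstad2016NoBLE, (5.16) p. 1092; Lemma 5.1 p. 1093] -/
theorem srwW_le_of_wPatLeTableZ {L : ℕ} {ext : ℚ} (hext : srwIZeroExtQ 10 44 T44 L ≤ ext) {prows : List PRow}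
    (hpt : posTableZB L ext prows = true) {w : ℕ → List ℕ → ℚ} {rows : List (ℕ × List ℕ)}
    (h : wPatLeTableR prows w rows = true) :
    ∀ r ∈ rows, r.1 ≤ 22 → r.2.length ≤ 10 → srwW 10 1 r.1 (vecOfParts 10 r.2) ≤ ((w r.1 r.2 : ℚ) : ℝ) := by
  intro r hr hj hp
  unfold wPatLeTableR at h
  rw [List.all_eq_true] at h
  have hle : wPatQR r.1 r.2 (refRows prows (2 * r.1)) ≤ w r.1 r.2 := of_decide_eq_true (h r hr)
  exact (srwW_le_wPatQR hj r.2 hp (refValid_refRowsZ hext hpt (2 * r.1))).trans (by exact_mod_cast hle)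

/-! ### §4. Sanity checks (kernel) -/

/-- The deep origin row agrees with the fast one at a small cut (`L = 12`, entries `0..12`). [folklore] -/
example : srwCountRowZip 10 12 [] = srwCountRowFast 10 12 [] := by decide +kernel
/-- A two-row toy deep table at `L = 30` with the slack value `1` passes the check (plumbing exercised). [folklore] -/
example : posTableZB 30 0 [([2, 1], [2, 1, 0, 0, 0, 0, 0, 0, 0, 0, 0, 0], [(14, 1), (16, 1)]),
    ([1, 1, 1], [3, 0, 0, 0, 0, 0, 0, 0, 0, 0, 0, 0], [(20, 1)])] = true := by decide +kernel

end WPatD10R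

end Literature.Probability.FitznerVanDerHofstad2017
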